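import Mathlib
import HarnessLib
import Summits.Ventures.LatticeQCDFlow.Exactness.JitteredHMC
import Summits.Ventures.LatticeQCDFlow.Exactness.GaugeFTHMCReversible

/-!
# The jittered HMC update satisfies DETAILED BALANCE, for every jitter law

HONEST FRAMING: exact (Metropolis-corrected) sampling algorithms for lattice gauge theory;
figures of merit are autocorrelation/cost numbers at stated couplings and volumes; no
continuum-physics claim.

Venture `LatticeQCDFlow` (cell pub-lqcd), topic `Exactness`, FANOUT row 9 (eng-latcore,
`hmc.HMC.trajectory(..., tau_jitter = j)`).  NEW WORK of the cell over the tree (`JitteredHMC.lean`: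
`jitterMap`, `jitterHMC` — the label carried in the momentum; row 14's `GaugeFTHMCReversible.lean`:
`hmc_config_isReversible`); nothing is cited as a fact; no number is claimed.  `JitteredHMC.jitterHMC_exact` gives invariance; reversibility is the hypothesis of
the cell's reversible-chain autocorrelation / `τ_int` theorems (`Scoring/ReversibleAutocorrelation*`), so it is
recorded here in its own right.

* **`jitterHMC_isReversible`** — for EVERY probability law `η` on the labels: if every `Φ_e` is a measurable
  `vol ⊗ volP`-preserving involution (jointly measurable) and `S`, `T` are measurable, the jittered update
  with the refresh `Z_T⁻¹e^{−T}·volP` is `e^{−S}·vol`-REVERSIBLE (it is `hmc_config_isReversible` for the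
  enlarged momentum `(p, e)`; no hypothesis on `Z_T`).
Instances: `SUNJitteredHMCExactStep.lean` (the engine's jittered `SU(N)` HMC as run is Wilson-reversible),
`Phi4JitteredHMC.lean` (the jittered φ⁴ HMC kernels are `e^{−S}·Leb`-reversible).

NOT CLAIMED: anything about autocorrelations themselves (the reversible-chain theorems take it from here);
floating point.
-/

noncomputable section

namespace Summit.Ventures.LatticeQCDFlow.Exactness

open MeasureTheory ProbabilityTheory ProbabilityTheory.Kernel Set Function
open scoped ENNReal

/-! ## §1 Abstract: the jittered update is reversible -/

section Abstract

variable {Ω P E : Type*} [MeasurableSpace Ω] [MeasurableSpace P] [MeasurableSpace E]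
  {Φ : E → Ω × P → Ω × P} {hΦ : Measurable (jitterMap Φ)} {S : Ω → ℝ} {T : P → ℝ}
  {vol : Measure Ω} {volP : Measure P} [SFinite vol] [SFinite volP]

/-- **`tau_jitter` SATISFIES DETAILED BALANCE, FOR EVERY JITTER LAW.**  Target `e^{−S}·vol`, kinetic term
`T`, refresh `Z_T⁻¹e^{−T}·volP`, a jointly measurable family `Φ_e` of `vol ⊗ volP`-preserving involutions,
`η` any probability law on the labels: the jittered update is `e^{−S}·vol`-reversible. -/
theorem jitterHMC_isReversible (η : Measure E) [IsProbabilityMeasure η] (hS : Measurable S)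
    (hT : Measurable T) (hinv : ∀ e, Involutive (Φ e))
    (hvol : ∀ e, MeasurePreserving (Φ e) (vol.prod volP) (vol.prod volP)) :
    IsReversible
      (jitterHMC Φ hΦ S T η
        ((volP.withDensity (fun π => ENNReal.ofReal (Real.exp (-T π))) univ)⁻¹ •
          volP.withDensity fun π => ENNReal.ofReal (Real.exp (-T π))))
      (vol.withDensity fun u => ENNReal.ofReal (Real.exp (-S u))) := by
  set νT := volP.withDensity fun π => ENNReal.ofReal (Real.exp (-T π)) with hνT
  have hTm : Measurable fun π => ENNReal.ofReal (Real.exp (-T π)) :=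
    (Real.measurable_exp.comp hT.neg).ennreal_ofReal
  have hT' : Measurable fun q : P × E => T q.1 := hT.comp measurable_fst
  have hνT' : (volP.prod η).withDensity (fun q : P × E => ENNReal.ofReal (Real.exp (-T q.1))) = νT.prod η := by
    rw [hνT, prod_withDensity_left hTm]
  have hZ' : (volP.prod η).withDensity (fun q : P × E => ENNReal.ofReal (Real.exp (-T q.1))) univ = νT univ := by
    rw [hνT', ← univ_prod_univ, Measure.prod_prod, show η univ = 1 from measure_univ, mul_one]
  have h := hmc_config_isReversible (vol := vol) (volP := volP.prod η) (hΦ := hΦ) (S := S)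
    (T := fun q : P × E => T q.1) hS hT' (jitterMap_involutive hinv) (measurePreserving_jitterMap hΦ hvol)
  beta_reduce at h
  rw [hZ', hνT', ← Measure.prod_smul_left] at h
  exact h

end Abstract

end Summit.Ventures.LatticeQCDFlow.Exactness
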